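import Literature.NumberTheory.Transcendental.KZCalculusProofs
import Mathlib.Analysis.SpecialFunctions.Pow.Real

/-!
# Toric assembly, part G: rational exponents (corners in `α^ℚ β^ℚ`)

Helper file for the stub `stub_toricAssembly` of the line `Sketch` (card `log-polytope-hilbert-three`)
of the crux `VolumeFormOffPlane` (stmt-KontsevichZagierPeriods-14935), route `SymplecticScissors`.

The registered sector statement (conclusion of `stub_toricAssembly`, hypothesis `hRTB` here) has
corners in `α^ℤ β^ℤ`; the card's headline `RankTwoToricFrame` allows corners `α^u β^v` with
RATIONAL `u, v`. The passage is formal: with `D` a common denominator of the finitely many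
exponents, `α' = α^{1/D}`, `β' = β^{1/D}` are again multiplicatively independent positive real
algebraic numbers (`IsAlgebraic.of_pow`) and `α^u = α'^{Du}` with `Du ∈ ℤ`; so the integral
statement for `(α', β')` is the rational statement for `(α, β)` (`toric_rtb_rat`).
-/

noncomputable section

open MeasureTheory Set
open Literature.NumberTheory.Transcendental

namespace Summit.KontsevichZagierPeriods.SymplecticScissors.LogPolytope

-- Shorthands used in the SOURCE of this file (work/toric/ToricG.src.lean, expanded by
-- work/toric/pp.py before checking/landing; the landed file is notation-free):
--   RTB = the registered conclusion of `stub_toricAssembly` (verbatim).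

/-- Integerisation of a rational by a multiple of its denominator:
`q.num * (D / q.den) = q * D` when `q.den ∣ D`. [folklore] -/
theorem toric_ratCast_num_mul_div : ∀ (q : ℚ) (D : ℕ), q.den ∣ D → ((q.num * ((D / q.den : ℕ) : ℤ) : ℤ) : ℚ) = q * D := by
  intro q D hD
  have hden : (q.den : ℚ) ≠ 0 := by exact_mod_cast q.den_ne_zero
  rw [Int.cast_mul, Int.cast_natCast, Nat.cast_div hD hden]
  conv_rhs => rw [← Rat.num_div_den q]
  field_simp

/-- The `D`-th root of a positive real algebraic number is algebraic, positive, and its integer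
powers realise the rational powers with denominator dividing `D`. [folklore] -/
theorem toric_root_facts {α : ℝ} (hα : 0 < α) (hαa : IsAlgebraic ℚ α) {D : ℕ} (hD : 0 < D) :
    0 < α ^ ((D : ℝ)⁻¹) ∧ IsAlgebraic ℚ (α ^ ((D : ℝ)⁻¹)) ∧ (α ^ ((D : ℝ)⁻¹)) ^ D = α ∧
      ∀ q : ℚ, q.den ∣ D →
        (α ^ ((D : ℝ)⁻¹)) ^ (q.num * ((D / q.den : ℕ) : ℤ)) = α ^ ((q : ℚ) : ℝ) := by
  have hD' : (D : ℝ) ≠ 0 := by exact_mod_cast hD.ne'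
  have hpos : 0 < α ^ ((D : ℝ)⁻¹) := Real.rpow_pos_of_pos hα _
  have hpow : (α ^ ((D : ℝ)⁻¹)) ^ D = α := by
    rw [← Real.rpow_natCast, ← Real.rpow_mul hα.le, inv_mul_cancel₀ hD', Real.rpow_one]
  refine ⟨hpos, IsAlgebraic.of_pow hD (by rwa [hpow]), hpow, fun q hq => ?_⟩
  rw [← Real.rpow_intCast, ← Real.rpow_mul hα.le]
  congr 1
  have h := toric_ratCast_num_mul_div q D hq
  have h' : (((q.num * ((D / q.den : ℕ) : ℤ) : ℤ) : ℚ) : ℝ) = ((q * D : ℚ) : ℝ) := by rw [h]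
  rw [Rat.cast_intCast, Rat.cast_mul, Rat.cast_natCast] at h'
  rw [h']
  field_simp

/-- Independence transfers to the `D`-th roots. [folklore] -/
theorem toric_indep_root {α β : ℝ} {D : ℕ} (hαD : (α ^ ((D : ℝ)⁻¹)) ^ D = α)
    (hβD : (β ^ ((D : ℝ)⁻¹)) ^ D = β)
    (hind : ∀ p q : ℤ, α ^ p * β ^ q = 1 → p = 0 ∧ q = 0) :
    ∀ p q : ℤ, (α ^ ((D : ℝ)⁻¹)) ^ p * (β ^ ((D : ℝ)⁻¹)) ^ q = 1 → p = 0 ∧ q = 0 := by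
  intro p q h
  apply hind p q
  have h' := congrArg (fun x : ℝ => x ^ D) h
  simp only [one_pow, mul_pow] at h'
  rw [← zpow_natCast, ← zpow_natCast, ← zpow_mul, ← zpow_mul, mul_comm p, mul_comm q, zpow_mul,
    zpow_mul, zpow_natCast, zpow_natCast, hαD, hβD] at h'
  exact h'

/-- **The rank-two toric box sector with RATIONAL exponents** (the card's `RankTwoToricFrame`):
from the integral-exponent sector statement (registered conclusion of `stub_toricAssembly`),
finite families of log-boxes with corners `α^u β^v`, `u, v ∈ ℚ` (`α, β` multiplicatively
independent positive real algebraic numbers), and equal total value are KZ-equivalent as formal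
sums, in every dimension `n + 1`. [folklore] -/
theorem toric_rtb_rat (hRTB : (∀ (n : ℕ) (α β : ℝ), 0 < α → 0 < β → IsAlgebraic ℚ α → IsAlgebraic ℚ β → (∀ p q : ℤ, α ^ p * β ^ q = 1 → p = 0 ∧ q = 0) → ∀ (k k' : ℕ) (u v u₁ v₁ : Fin k → Fin n → ℤ) (s t s₁ t₁ : Fin k' → Fin n → ℤ) (r : Fin k → KZ.IntegralRep (n + 1)) (r' : Fin k' → KZ.IntegralRep (n + 1)), (∀ i j, α ^ u i j * β ^ v i j < α ^ u₁ i j * β ^ v₁ i j) → (∀ i j, α ^ s i j * β ^ t i j < α ^ s₁ i j * β ^ t₁ i j) → (∀ i, (r i).domain = {p : Fin (n + 1) → ℝ | (∀ j : Fin n, α ^ u i j * β ^ v i j < p (Fin.castSucc j) ∧ p (Fin.castSucc j) < α ^ u₁ i j * β ^ v₁ i j) ∧ 0 < p (Fin.last n) ∧ p (Fin.last n) * ∏ j : Fin n, p (Fin.castSucc j) < 1}) → (∀ i, ∀ p ∈ (r i).domain, (r i).integrand p = 1) → (∀ i, (r' i).domain = {p : Fin (n + 1) → ℝ | (∀ j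 : Fin n, α ^ s i j * β ^ t i j < p (Fin.castSucc j) ∧ p (Fin.castSucc j) < α ^ s₁ i j * β ^ t₁ i j) ∧ 0 < p (Fin.last n) ∧ p (Fin.last n) * ∏ j : Fin n, p (Fin.castSucc j) < 1}) → (∀ i, ∀ p ∈ (r' i).domain, (r' i).integrand p = 1) → ∑ i, (r i).value = ∑ i, (r' i).value → ∑ i, KZ.of (r i) - ∑ i, KZ.of (r' i) ∈ KZ.relations)) : ∀ (n : ℕ) (α β : ℝ), 0 < α → 0 < β → IsAlgebraic ℚ α → IsAlgebraic ℚ β → (∀ p q : ℤ, α ^ p * β ^ q = 1 → p = 0 ∧ q = 0) → ∀ (k k' : ℕ) (u v u₁ v₁ : Fin k → Fin n → ℚ) (s t s₁ t₁ : Fin k' → Fin n → ℚ) (r : Fin k → KZ.IntegralRep (n + 1)) (r' : Fin k' → KZ.IntegralRep (n + 1)), (∀ i j, α ^ ((u i j : ℚ) : ℝ) * β ^ ((v i j : ℚ) : ℝ) < α ^ ((u₁ i j : ℚ) : ℝ) * β ^ ((v₁ i j : ℚ) : ℝ)) → (∀ i j, α ^ ((s i j : ℚ) : ℝ) * β ^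 ((t i j : ℚ) : ℝ) < α ^ ((s₁ i j : ℚ) : ℝ) * β ^ ((t₁ i j : ℚ) : ℝ)) → (∀ i, (r i).domain = {p : Fin (n + 1) → ℝ | (∀ j : Fin n, α ^ ((u i j : ℚ) : ℝ) * β ^ ((v i j : ℚ) : ℝ) < p (Fin.castSucc j) ∧ p (Fin.castSucc j) < α ^ ((u₁ i j : ℚ) : ℝ) * β ^ ((v₁ i j : ℚ) : ℝ)) ∧ 0 < p (Fin.last n) ∧ p (Fin.last n) * ∏ j : Fin n, p (Fin.castSucc j) < 1}) → (∀ i, ∀ p ∈ (r i).domain, (r i).integrand p = 1) → (∀ i, (r' i).domain = {p : Fin (n + 1) → ℝ | (∀ j : Fin n, α ^ ((s i j : ℚ) : ℝ) * β ^ ((t i j : ℚ) : ℝ) < p (Fin.castSucc j) ∧ p (Fin.castSucc j) < α ^ ((s₁ i j : ℚ) : ℝ) * β ^ ((t₁ i j : ℚ) : ℝ)) ∧ 0 < p (Fin.last n) ∧ p (Fin.last n) * ∏ j : Fin n, p (Fin.castSucc j) < 1}) → (∀ i, ∀ p ∈ (r' i).domain, (r' i).integrand p = 1) → ∑ i, (r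 i).value = ∑ i, (r' i).value → ∑ i, KZ.of (r i) - ∑ i, KZ.of (r' i) ∈ KZ.relations := by
  intro n α β hα hβ hαa hβa hind k k' u v u₁ v₁ s t s₁ t₁ r r' hlt hlt' hrd hr hrd' hr' hv
  classical
  -- the finitely many exponents and a common denominator
  set S : Finset ℚ :=
    (Finset.univ.image fun ij : Fin k × Fin n => u ij.1 ij.2) ∪
    (Finset.univ.image fun ij : Fin k × Fin n => v ij.1 ij.2) ∪
    (Finset.univ.image fun ij : Fin k × Fin n => u₁ ij.1 ij.2) ∪
    (Finset.univ.image fun ij : Fin k × Fin n => v₁ ij.1 ij.2) ∪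
    (Finset.univ.image fun ij : Fin k' × Fin n => s ij.1 ij.2) ∪
    (Finset.univ.image fun ij : Fin k' × Fin n => t ij.1 ij.2) ∪
    (Finset.univ.image fun ij : Fin k' × Fin n => s₁ ij.1 ij.2) ∪
    (Finset.univ.image fun ij : Fin k' × Fin n => t₁ ij.1 ij.2) with hS
  set D : ℕ := ∏ q ∈ S, q.den with hDdef
  have hD : 0 < D := Finset.prod_pos fun q _ => q.den_pos
  have hdvd : ∀ q ∈ S, q.den ∣ D := fun q hq => Finset.dvd_prod_of_mem _ hq
  have hu : ∀ i j, u i j ∈ S := fun i j => by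
    simp only [hS, Finset.mem_union, Finset.mem_image, Finset.mem_univ, true_and, Prod.exists]
    exact Or.inl (Or.inl (Or.inl (Or.inl (Or.inl (Or.inl (Or.inl ⟨i, j, rfl⟩))))))
  have hv' : ∀ i j, v i j ∈ S := fun i j => by
    simp only [hS, Finset.mem_union, Finset.mem_image, Finset.mem_univ, true_and, Prod.exists]
    exact Or.inl (Or.inl (Or.inl (Or.inl (Or.inl (Or.inl (Or.inr ⟨i, j, rfl⟩))))))
  have hu₁ : ∀ i j, u₁ i j ∈ S := fun i j => by
    simp only [hS, Finset.mem_union, Finset.mem_image, Finset.mem_univ, true_and, Prod.exists]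
    exact Or.inl (Or.inl (Or.inl (Or.inl (Or.inl (Or.inr ⟨i, j, rfl⟩)))))
  have hv₁ : ∀ i j, v₁ i j ∈ S := fun i j => by
    simp only [hS, Finset.mem_union, Finset.mem_image, Finset.mem_univ, true_and, Prod.exists]
    exact Or.inl (Or.inl (Or.inl (Or.inl (Or.inr ⟨i, j, rfl⟩))))
  have hs : ∀ i j, s i j ∈ S := fun i j => by
    simp only [hS, Finset.mem_union, Finset.mem_image, Finset.mem_univ, true_and, Prod.exists]
    exact Or.inl (Or.inl (Or.inl (Or.inr ⟨i, j, rfl⟩)))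
  have ht : ∀ i j, t i j ∈ S := fun i j => by
    simp only [hS, Finset.mem_union, Finset.mem_image, Finset.mem_univ, true_and, Prod.exists]
    exact Or.inl (Or.inl (Or.inr ⟨i, j, rfl⟩))
  have hs₁ : ∀ i j, s₁ i j ∈ S := fun i j => by
    simp only [hS, Finset.mem_union, Finset.mem_image, Finset.mem_univ, true_and, Prod.exists]
    exact Or.inl (Or.inr ⟨i, j, rfl⟩)
  have ht₁ : ∀ i j, t₁ i j ∈ S := fun i j => by
    simp only [hS, Finset.mem_union, Finset.mem_image, Finset.mem_univ, true_and, Prod.exists]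
    exact Or.inr ⟨i, j, rfl⟩
  -- the roots
  obtain ⟨hα', hα'a, hαD, hαq⟩ := toric_root_facts hα hαa hD
  obtain ⟨hβ', hβ'a, hβD, hβq⟩ := toric_root_facts hβ hβa hD
  have hind' := toric_indep_root hαD hβD hind
  -- integerised exponents
  have key := hRTB n (α ^ ((D : ℝ)⁻¹)) (β ^ ((D : ℝ)⁻¹)) hα' hβ' hα'a hβ'a hind' k k'
    (fun i j => (u i j).num * ((D / (u i j).den : ℕ) : ℤ))
    (fun i j => (v i j).num * ((D / (v i j).den : ℕ) : ℤ))
    (fun i j => (u₁ i j).num * ((D / (u₁ i j).den : ℕ) : ℤ))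
    (fun i j => (v₁ i j).num * ((D / (v₁ i j).den : ℕ) : ℤ))
    (fun i j => (s i j).num * ((D / (s i j).den : ℕ) : ℤ))
    (fun i j => (t i j).num * ((D / (t i j).den : ℕ) : ℤ))
    (fun i j => (s₁ i j).num * ((D / (s₁ i j).den : ℕ) : ℤ))
    (fun i j => (t₁ i j).num * ((D / (t₁ i j).den : ℕ) : ℤ)) r r'
  simp only [hαq _ (hdvd _ (hu _ _)), hαq _ (hdvd _ (hu₁ _ _)), hαq _ (hdvd _ (hs _ _)),
    hαq _ (hdvd _ (hs₁ _ _)), hβq _ (hdvd _ (hv' _ _)), hβq _ (hdvd _ (hv₁ _ _)),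
    hβq _ (hdvd _ (ht _ _)), hβq _ (hdvd _ (ht₁ _ _))] at key
  exact key hlt hlt' hrd hr hrd' hr' hv

end Summit.KontsevichZagierPeriods.SymplecticScissors.LogPolytope

end
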